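import Summits.BirchSwinnertonDyer.Rank1Residual.Additive.GoodModelNoLocalCondition
import Summits.BirchSwinnertonDyer.Rank1Residual.Additive.GoodModelKernelH1Layer
import Summits.BirchSwinnertonDyer.Rank1Residual.GaloisImage.TorsionCocycleDescent
import Literature.NumberTheory.GaloisRepresentations.AbsGaloisGroupCompact
import HarnessLib

/-!
# No local condition at a potentially good SUPERSINGULAR `v ∣ p` over `K_∞` WITHOUT a prime-to-`p`
# fixing level: descent along a FINITE (possibly wild) layer from the divisibility of
# `H¹((K_∞)_η, E[p^∞])` — row T-CG-W file F3b (cell `b2b-bsdres`, team n1011; seat n1011-p05 GEN 10)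

HONEST FRAMING (cell `b2b-bsdres`, run/shared/lean/b2b/bsd-rank1-residual/, verbatim in every
file): the goal of the cell is to DELETE the COMBINATION-SHAPED residual classes of the
Birch–Swinnerton-Dyer formula for ALL analytic-rank `≤ 1` elliptic curves over `ℚ` — "full BSD
formula for every rank `≤ 1` curve in class `C`" assembled STRICTLY from published theorems — so
that the rank-`≤ 1` remainder becomes exactly the CONSTRUCTION-SHAPED classes, which are TYPED
(missing-input `Prop`s), NOT attempted. This is not "finishing BSD". Team n1011 / class O6 of
RESIDUAL-MAP §I (WILD potentially supersingular additive `3`): research route; TOOL theorems of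
Galois cohomology; no definition, no NEW named fact IN THIS FILE (the Coates–Greenberg record
`CoatesGreenberg1996.H1_goodModelKernel_trivial` = A254, DERIVED from A256 by
`H1_goodModelKernel_trivial_of_deeplyRamifiedTrace`, is carried as `hCG`; the divisibility of the
local `H¹` is carried as an EXPLICIT hypothesis `hdiv`); nothing booked, no mark moves, closes no
pair.

## Why (the located gap of the O6 item of T-CG-SS)

S1 (`GoodModelNoLocalCondition`) proves "no local condition at `v` over `K_∞`" for a good
SUPERSINGULAR model `W₀ = C • E ⊗ K̄_v` by (§1) the level vanishing over a closed `H ≤ ker κ` whose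
local group FIXES `C`, and (§2) PRIME-TO-`p` corestriction descent. When the semistability defect
is divisible by `p` (class O6: `p = 3`, Kodaira II/IV/IV*/II*) no prime-to-`p` level fixes `C`.
The printed argument ([CoGr] Props. 4.3 + 4.8, quoted by Coates, LNM 1716 §3 (proof of Lemma 3.5):
"`H¹(F_∞,w, E)(p) ≃ H¹(F_∞,w, D)` … `D = 0` if and only if `E` has potential supersingular
reduction at `v`"; Greenberg, LNM 1716 §2) descends along the FINITE layer `L M/L`
(`L = (K_∞)_η`, `M/K_v` a good-reduction field) using `cd_p(G_L) = 1` (Greenberg §2, proof of Prop. 2.4, and §4, Lemma 4.5 ¶: "`G_{(F_∞)_η}` has `p`-cohomological dimension 1. Hence `H¹((F_∞)_η, E[p^∞])` must be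
divisible").

## What

* §1 = the ABSTRACT descent of `GaloisImage/TorsionCocycleDescent.lean` (F3a:
  `Descent.exists_index_nsmul_eq_smul_sub` — elementary corestriction `[G : N] • φ = ∂b` for a
  crossed homomorphism vanishing on a finite-index `N`; `Descent.exists_eq_smul_sub_of_divisible_of_level`
  — for COMPACT `G`: `H¹(G, M[p^∞])` `p`-divisible + torsion-valued cocycles principal ON a
  finite-index `N` ⟹ principal on `G`; no normality, NO coprimality of `[G : N]` to `p`).
* §2 `exists_eq_smul_sub_of_pow_smul_eq_zero_of_level` — the LOCAL CORE of S1 §1 (generic number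
  field `K : Type`, `κ` cyclotomic, `v ∋ p`): for a closed `G' ≤ (ker κ)_v` fixing `C`, every
  continuous crossed homomorphism `G' → E(K̄_v)` with `p`-power-torsion values is principal
  (values lie in `Φ_C⁻¹ Ŵ₀(𝔪̄)` by `htors`; `hCG`).
* §3 `exists_eq_smul_sub_of_pow_smul_eq_zero_of_divisible` — §1's descent on `G = (ker κ)_v`
  (compact) with `N = G ∩ O`, `O ≤ Γ_{K_v}` a closed subgroup fixing `C` with `G/(G ∩ O)` finite,
  the level hypothesis supplied by §2.
* §4 `exists_isClosed_finite_map_eq` (such an `O`: the fixing subgroup of the normal closure of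
  `K_v(u, r, s, t)`), `localKerOver_kerSubgroup_eq_top_of_torsion_mem_kernel_of_divisible` (no
  local condition at `v` over `K_∞`), `not_isTorsion_of_torsion_mem_kernel_of_divisible`
  (Greenberg Thm. 1.7 mechanism, mod `hCG`, `hdiv`, (I1)) — the twins of S1 §2–§3 WITHOUT the
  prime-to-`p` level.

References: R. Greenberg, LNM 1716 (1999) Thm. 1.7, §2 (proof of Prop. 2.4; the potentially supersingular paragraph), §4 (Lemma 4.5 and the paragraph following it)
[GreenbergLNM1716]; J. Coates, LNM 1716 §3 (proof of Lemma 3.5); J. Coates, R. Greenberg, Invent. Math. 124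
(1996) §4 Props. 4.3, 4.8 [CoatesGreenberg1996]; D. Harari, *Galois cohomology and class field
theory*, Thm. 8.11 (a) [Harari2020]; J.-P. Serre, *Galois Cohomology* I.§2.4, II.§3.3
[SerreGaloisCohomology1997]; skeleton `cells/n1011/skel/T-CG-W.md`.
-/

noncomputable section

open scoped Classical NNReal

open WeierstrassCurve

universe u

namespace Summit.BirchSwinnertonDyer.Rank1Residual.Additive.GoodModelLine

open NumberField IsDedekindDomain Field IsDedekindDomain.HeightOneSpectrum
  Literature.NumberTheory.GaloisRepresentations Literature.NumberTheory.EllipticCurves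
  Literature.NumberTheory.EllipticCurves.GreenbergSelmer
  Literature.NumberTheory.EllipticCurves.CoatesGreenberg1996
  Summit.BirchSwinnertonDyer.Rank1Residual.X2.GreenbergVatsalSelmerLink
  Summit.BirchSwinnertonDyer.Rank1Residual.GaloisImage


/-! ## §2 The local core of S1 §1: torsion-valued cocycles over a level fixing the good
supersingular model are principal -/

variable {K : Type} [Field K] [NumberField K] (W : WeierstrassCurve K) [W.IsElliptic] (p : ℕ)
  [hp : Fact p.Prime] {v : HeightOneSpectrum (𝓞 K)}
  {w : Valuation (AlgebraicClosure (v.adicCompletion K)) ℝ≥0}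
  (hw : ∀ x, (w x : ℝ) =
    spectralNorm (v.adicCompletion K) (AlgebraicClosure (v.adicCompletion K)) x)
  {C : VariableChange (AlgebraicClosure (v.adicCompletion K))}
  {W₀ : WeierstrassCurve w.integer}
  (hW₀ : C • (W.baseChange (v.adicCompletion K)).baseChange (AlgebraicClosure (v.adicCompletion K)) =
    W₀.baseChange (AlgebraicClosure (v.adicCompletion K)))
  (hΔ : IsUnit W₀.Δ)
  /- SUPERSINGULAR residue: every `p`-power torsion point of `E(K̄_v)` lies in the kernel of
  reduction of the good model (`W̃₀(k̄)[p] = 0`). -/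
  (htors : ∀ P : localPoints W (v.adicCompletion K), (∃ k : ℕ, p ^ k • P = 0) →
    Affine.Point.congrEquiv hW₀ (VariableChange.pointEquiv _ C
      (Affine.Point.congrEquiv (baseChange_baseChange_adicCompletion W v).symm P)) ∈
      kernelOfReduction W₀ (Valuation.integer.integers w))

include hw hΔ htors in
/-- **Local core of S1 §1** (mod the Coates–Greenberg record): for `κ` cyclotomic, `v ∋ p`, a good
model `W₀ = C • E ⊗ K̄_v` all of whose `p`-power torsion reduces to `Õ`, and a CLOSED
`G' ≤ (ker κ)_v` whose elements fix `C`, every continuous crossed homomorphism `F : G' → E(K̄_v)`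
with `p`-power-torsion values is principal — its values lie in `Φ_C⁻¹(Ŵ₀(𝔪̄))` (`htors`), so
`hCG` applies. Greenberg, LNM 1716 §2 ("`C_v = E[p^∞]` since `Ẽ[p^∞] = 0`").
[cite: GreenbergLNM1716, §2 (potentially supersingular primes: C_v = E[p^∞])] [cite: CoatesGreenberg1996, Cor. 3.2 (through GreenbergLNM1716)] -/
theorem exists_eq_smul_sub_of_pow_smul_eq_zero_of_level (hCG : H1_goodModelKernel_trivial.{0})
    (κ : ZpExtension K p) (hκ : κ.IsCyclotomic) (hpv : ((p : ℕ) : 𝓞 K) ∈ v.asIdeal)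
    (G' : Subgroup (absoluteGaloisGroup (v.adicCompletion K)))
    (hG'c : IsClosed (G' : Set (absoluteGaloisGroup (v.adicCompletion K))))
    (hG'κ : G' ≤ localSubgroup κ.kerSubgroup (v.adicCompletion K))
    (hG'C : ∀ σ ∈ G', C.map ((absoluteGaloisGroup.toAlgEquiv (v.adicCompletion K) σ :
          AlgebraicClosure (v.adicCompletion K) ≃ₐ[v.adicCompletion K]
            AlgebraicClosure (v.adicCompletion K)) :
          AlgebraicClosure (v.adicCompletion K) →+* AlgebraicClosure (v.adicCompletion K)) = C)
    (F : contOneCocycles (discreteTopRep G' (localPoints W (v.adicCompletion K))))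
    (hF : ∀ τ, ∃ k : ℕ, p ^ k • F.1 τ = 0) :
    ∃ a : localPoints W (v.adicCompletion K), ∀ τ : G', F.1 τ = τ • a - a := by
  have hkernel : ∀ τ : G', Affine.Point.congrEquiv hW₀ (VariableChange.pointEquiv _ C
      (Affine.Point.congrEquiv (baseChange_baseChange_adicCompletion W v).symm (F.1 τ))) ∈
        kernelOfReduction W₀ (Valuation.integer.integers w) := fun τ ↦ htors _ (hF τ)
  obtain ⟨a, -, ha⟩ := hCG K W p κ hκ v hpv w hw C W₀ hW₀ hΔ G' hG'c hG'κ hG'C F hkernel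
  exact ⟨a, ha⟩

/-! ## §3 The descent along a finite (possibly wild) layer, from the divisibility of
`H¹(G, E(K̄_v)[p^∞])` -/

include hw hΔ htors in
/-- **The descent.** Let `κ` be cyclotomic, `v ∋ p`, `G = (ker κ)_v`, `W₀ = C • E ⊗ K̄_v` a good
model all of whose `p`-power torsion reduces to `Õ`, and `O ≤ Γ_{K_v}` a CLOSED subgroup whose
elements fix `C`, with `G/(G ∩ O)` finite (e.g. `O = Gal(K̄_v/M₁)`, `M₁/K_v` finite normal
containing the entries of `C`; NO coprimality of `[G : G ∩ O]` to `p`). Assume (`hdiv`) that every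
class of `H¹(G, E(K̄_v)[p^∞])` is divisible by `p`. Then every continuous crossed homomorphism
`F : G → E(K̄_v)` with `p`-power-torsion values is principal. Proof (module docstring §3):
`[F] = p^s [F']` in `H¹(G, E[p^∞])`, `s = [G : G ∩ O]`; `F'|_{G ∩ O} = ∂a₁` (§2) so `s [F'] = 0`
in `H¹(G, E(K̄_v))` (§1); `p^{k'} [F'] = 0`; `gcd(s, p^{k'}) ∣ p^s`; hence `[F] = p^s [F'] = 0`.
This is the descent step of [CoGr] §4 (Props. 4.3/4.8 as quoted by Coates, LNM 1716 §3 (proof of Lemma 3.5)) /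
Greenberg LNM 1716 §2, with `cd_p(G_{(K_∞)_η}) = 1` entering only through `hdiv`
(Greenberg §4, Lemma 4.5 ¶).
[cite: GreenbergLNM1716, §2 (proof of Prop. 2.4; the potentially supersingular paragraph) and §4 (Lemma 4.5 and the paragraph following it)] [cite: CoatesGreenberg1996, §4 Props. 4.3, 4.8 (through Coates, LNM 1716 §3, proof of Lemma 3.5)] -/
theorem exists_eq_smul_sub_of_pow_smul_eq_zero_of_divisible (hCG : H1_goodModelKernel_trivial.{0})
    (κ : ZpExtension K p) (hκ : κ.IsCyclotomic) (hpv : ((p : ℕ) : 𝓞 K) ∈ v.asIdeal)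
    (O : Subgroup (absoluteGaloisGroup (v.adicCompletion K)))
    (hOc : IsClosed (O : Set (absoluteGaloisGroup (v.adicCompletion K))))
    [Finite (localSubgroup κ.kerSubgroup (v.adicCompletion K) ⧸
      O.subgroupOf (localSubgroup κ.kerSubgroup (v.adicCompletion K)))]
    (hOC : ∀ σ ∈ O, C.map ((absoluteGaloisGroup.toAlgEquiv (v.adicCompletion K) σ :
          AlgebraicClosure (v.adicCompletion K) ≃ₐ[v.adicCompletion K]
            AlgebraicClosure (v.adicCompletion K)) :
          AlgebraicClosure (v.adicCompletion K) →+* AlgebraicClosure (v.adicCompletion K)) = C)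
    (hdiv : ∀ c : discreteH1 (localSubgroup κ.kerSubgroup (v.adicCompletion K))
      (AddCommGroup.primaryComponent (localPoints W (v.adicCompletion K)) p),
      ∃ c', c = p • c')
    (F : contOneCocycles (discreteTopRep (localSubgroup κ.kerSubgroup (v.adicCompletion K))
      (localPoints W (v.adicCompletion K))))
    (hF : ∀ τ, ∃ k : ℕ, p ^ k • F.1 τ = 0) :
    ∃ a : localPoints W (v.adicCompletion K),
      ∀ τ : localSubgroup κ.kerSubgroup (v.adicCompletion K), F.1 τ = τ • a - a := by
  haveI : CompactSpace (absoluteGaloisGroup (v.adicCompletion K)) :=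
    absoluteGaloisGroup_compactSpace (v.adicCompletion K)
  have hGc : IsClosed (localSubgroup κ.kerSubgroup (v.adicCompletion K) :
      Set (absoluteGaloisGroup (v.adicCompletion K))) :=
    κ.isClosed_kerSubgroup.preimage (map_continuous (resGal (K := K) (v.adicCompletion K)))
  haveI : CompactSpace (localSubgroup κ.kerSubgroup (v.adicCompletion K)) :=
    isCompact_iff_compactSpace.mp hGc.isCompact
  have hUO : (localSubgroup κ.kerSubgroup (v.adicCompletion K) ⊓ O :
      Subgroup (absoluteGaloisGroup (v.adicCompletion K))) ≤
        localSubgroup κ.kerSubgroup (v.adicCompletion K) := inf_le_left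
  refine Descent.exists_eq_smul_sub_of_divisible_of_level
    (O.subgroupOf (localSubgroup κ.kerSubgroup (v.adicCompletion K))) hdiv (fun F' hF' ↦ ?_) F hF
  -- level vanishing on `G ∩ O` (§2), transported to the subgroup `O.subgroupOf G` of `G`
  obtain ⟨a₁, ha₁⟩ := exists_eq_smul_sub_of_pow_smul_eq_zero_of_level W p hw hW₀ hΔ htors hCG κ
    hκ hpv (localSubgroup κ.kerSubgroup (v.adicCompletion K) ⊓ O) (hGc.inter hOc) inf_le_left
    (fun σ hσ ↦ hOC σ (Subgroup.mem_inf.mp hσ).2)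
    (contOneCocycles.pullback (subgroupInclusion hUO)
      (resHomOfEquivariant (subgroupInclusion hUO) (AddMonoidHom.id _) fun _ _ ↦ rfl) F')
    (fun τ ↦ by
      obtain ⟨k, hk⟩ := hF' (Subgroup.inclusion hUO τ)
      exact ⟨k, hk⟩)
  refine ⟨a₁, fun g hg ↦ ?_⟩
  have hg' : (g : absoluteGaloisGroup (v.adicCompletion K)) ∈
      localSubgroup κ.kerSubgroup (v.adicCompletion K) ⊓ O :=
    Subgroup.mem_inf.mpr ⟨g.2, Subgroup.mem_subgroupOf.mp hg⟩
  have h := ha₁ ⟨g, hg'⟩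
  exact h

/-! ## §4 A closed finite-index level fixing `C`; no local condition at `v` over `K_∞`;
Greenberg Thm. 1.7 -/

omit [W.IsElliptic] hp in
/-- **A closed subgroup of finite index in `G` fixing `C`.** For any change of variables `C` over
`K̄_v` and any subgroup `G ≤ Γ_{K_v}`: the fixing subgroup `O = Gal(K̄_v/M₁)` of the normal
closure `M₁` of `K_v(u, r, s, t)` (a finite normal extension of `K_v`) is closed, `G/(G ∩ O)` is
finite, and the elements of `O` fix `C`. [folklore] -/
theorem exists_isClosed_finite_map_eq (C : VariableChange (AlgebraicClosure (v.adicCompletion K)))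
    (G : Subgroup (absoluteGaloisGroup (v.adicCompletion K))) :
    ∃ O : Subgroup (absoluteGaloisGroup (v.adicCompletion K)),
      IsClosed (O : Set (absoluteGaloisGroup (v.adicCompletion K))) ∧ Finite (G ⧸ O.subgroupOf G) ∧
      ∀ σ ∈ O, C.map ((absoluteGaloisGroup.toAlgEquiv (v.adicCompletion K) σ :
          AlgebraicClosure (v.adicCompletion K) ≃ₐ[v.adicCompletion K]
            AlgebraicClosure (v.adicCompletion K)) :
          AlgebraicClosure (v.adicCompletion K) →+* AlgebraicClosure (v.adicCompletion K)) = C := by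
  set S₀ : Set (AlgebraicClosure (v.adicCompletion K)) :=
    {(C.u : AlgebraicClosure (v.adicCompletion K)), C.r, C.s, C.t} with hS₀
  haveI : Finite S₀ := (Set.toFinite S₀).to_subtype
  haveI hfd : FiniteDimensional (v.adicCompletion K)
      (IntermediateField.adjoin (v.adicCompletion K) S₀) :=
    IntermediateField.finiteDimensional_adjoin fun z _ ↦
      (Algebra.IsAlgebraic.isAlgebraic (R := v.adicCompletion K) z).isIntegral
  set M₁ : IntermediateField (v.adicCompletion K) (AlgebraicClosure (v.adicCompletion K)) :=
    IntermediateField.normalClosure (v.adicCompletion K)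
      (IntermediateField.adjoin (v.adicCompletion K) S₀) (AlgebraicClosure (v.adicCompletion K))
    with hM₁
  haveI : FiniteDimensional (v.adicCompletion K) M₁ := by rw [hM₁]; infer_instance
  haveI : Normal (v.adicCompletion K) M₁ := by rw [hM₁]; infer_instance
  have hS₀M₁ : S₀ ⊆ (M₁ : Set (AlgebraicClosure (v.adicCompletion K))) :=
    (IntermediateField.subset_adjoin (v.adicCompletion K) S₀).trans
      (IntermediateField.le_normalClosure (IntermediateField.adjoin (v.adicCompletion K) S₀))
  set O : Subgroup (absoluteGaloisGroup (v.adicCompletion K)) :=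
    M₁.fixingSubgroup.comap (absoluteGaloisGroup.toAlgEquiv (v.adicCompletion K)).toMonoidHom
    with hO
  have hO_mem : ∀ τ, τ ∈ O ↔
      absoluteGaloisGroup.toAlgEquiv (v.adicCompletion K) τ ∈ M₁.fixingSubgroup := fun _ ↦
    Subgroup.mem_comap
  have hOopen : IsOpen (O : Set (absoluteGaloisGroup (v.adicCompletion K))) :=
    M₁.fixingSubgroup_isOpen
  refine ⟨O, Subgroup.isClosed_of_isOpen O hOopen,
    KernelH1.finite_quotient_subgroupOf_fixingSubgroup M₁ G, fun σ hσ ↦ ?_⟩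
  have hfix : ∀ z ∈ S₀, (absoluteGaloisGroup.toAlgEquiv (v.adicCompletion K) σ) z = z :=
    fun z hz ↦ (IntermediateField.mem_fixingSubgroup_iff _ _).mp ((hO_mem σ).mp hσ) z (hS₀M₁ hz)
  exact KernelH1.variableChange_map_eq_of_apply_eq C _ (hfix _ (by simp [hS₀]))
    (hfix _ (by simp [hS₀])) (hfix _ (by simp [hS₀])) (hfix _ (by simp [hS₀]))

include hw hΔ htors in
/-- **No local condition at `v` over `K_∞` for a good SUPERSINGULAR model, WITHOUT a prime-to-`p`
level** (mod the Coates–Greenberg record and the divisibility of `H¹((K_∞)_η, E[p^∞])`): if every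
class of `H¹((ker κ)_v, E(K̄_v)[p^∞])` is `p`-divisible, then `W.localKerOver p (ker κ) K_v = ⊤` —
every class of `H¹(K_∞, E[p^∞])` satisfies the Kummer condition at `v` (§3 with the level of
`exists_isClosed_finite_map_eq`). Greenberg, LNM 1716 §2: "if `E` has potentially supersingular
reduction at `v` … and if `M_η/F_v` is deeply ramified … the groups `H¹(M_η, E[p^∞])/Im(κ_η)` …
are simply zero." — here for ARBITRARY (possibly wild) semistability defect.
[cite: GreenbergLNM1716, §2 (proof of Prop. 2.4; the potentially supersingular paragraph) and §4 (Lemma 4.5 and the paragraph following it)] [cite: CoatesGreenberg1996, §4 Props. 4.3, 4.8 (through Coates, LNM 1716 §3, proof of Lemma 3.5) and Cor. 3.2] -/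
theorem localKerOver_kerSubgroup_eq_top_of_torsion_mem_kernel_of_divisible
    (hCG : H1_goodModelKernel_trivial.{0}) (κ : ZpExtension K p) (hκ : κ.IsCyclotomic)
    (hpv : ((p : ℕ) : 𝓞 K) ∈ v.asIdeal)
    (hdiv : ∀ c : discreteH1 (localSubgroup κ.kerSubgroup (v.adicCompletion K))
      (AddCommGroup.primaryComponent (localPoints W (v.adicCompletion K)) p),
      ∃ c', c = p • c') :
    W.localKerOver p κ.kerSubgroup (v.adicCompletion K) = ⊤ := by
  obtain ⟨O, hOc, hOfin, hOC⟩ :=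
    exists_isClosed_finite_map_eq (v := v) C (localSubgroup κ.kerSubgroup (v.adicCompletion K))
  haveI := hOfin
  rw [eq_top_iff]
  rintro c -
  obtain ⟨f, rfl⟩ := oneCocycleClass_surjective (discreteTopRep κ.kerSubgroup
    (W.geomPrimaryTorsion p)) c
  -- the pulled-back cocycle `F τ = ι (f (res τ))` on `G = (ker κ)_v`
  set F : contOneCocycles (discreteTopRep (localSubgroup κ.kerSubgroup (v.adicCompletion K))
      (localPoints W (v.adicCompletion K))) :=
    contOneCocycles.pullback (resGalSubgroup κ.kerSubgroup (v.adicCompletion K))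
      (resHomOfEquivariant (resGalSubgroup κ.kerSubgroup (v.adicCompletion K))
        ((pointsMap W (v.adicCompletion K)).comp (W.geomPrimaryTorsion p).subtype) fun τ P ↦ by
          simp only [AddMonoidHom.coe_comp, AddSubgroup.coe_subtype, Function.comp_apply,
            Subgroup.smul_def, resGalSubgroup_apply_coe,
            Literature.NumberTheory.EllipticCurves.primaryComponent.coe_smul]
          exact pointsMap_smul W (v.adicCompletion K) τ P) f with hF
  have hFapply : ∀ τ, F.1 τ = pointsMap W (v.adicCompletion K)
      ((f.1 (resGalSubgroup κ.kerSubgroup (v.adicCompletion K) τ) : W.geomPrimaryTorsion p) :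
        W.geomPoints) := fun τ ↦ rfl
  have hFtors : ∀ τ, ∃ k : ℕ, p ^ k • F.1 τ = 0 := by
    intro τ
    rw [hFapply]
    obtain ⟨k, hk⟩ := (AddCommGroup.mem_primaryComponent).mp
      (f.1 (resGalSubgroup κ.kerSubgroup (v.adicCompletion K) τ)).2
    exact ⟨k, by rw [← map_nsmul, hk, map_zero]⟩
  obtain ⟨a, ha⟩ := exists_eq_smul_sub_of_pow_smul_eq_zero_of_divisible W p hw hW₀ hΔ htors hCG κ
    hκ hpv O hOc hOC hdiv F hFtors
  refine (oneCocycleClass_mem_localKerOver_iff W p κ.kerSubgroup (v.adicCompletion K) f).2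
    ⟨a, fun τ ↦ ?_⟩
  have h := ha τ
  rw [hFapply, Subgroup.smul_def] at h
  exact h

include hw hΔ htors in
/-- **`Sel_{p^∞}(E/K_∞)` is NOT `Λ`-cotorsion at a potentially good SUPERSINGULAR prime of ARBITRARY
semistability defect** (Greenberg, LNM 1716 Thm. 1.7 (Schneider): "`corank_Λ(Sel_E(F_∞)_p)
≥ r(E, F)`, `r(E,F) = Σ_{pss} [F_v : ℚ_p]` … over the primes `v` of `F` where `E` has potentially
supersingular reduction"), mod the Coates–Greenberg record `hCG`, the divisibility of
`H¹((K_∞)_η, E[p^∞])` (`hdiv`) and the relaxed finite-level Selmer count (I1)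
`relaxedSelmer_torsion_card_growth`: the local condition at `v` over `K_∞` is vacuous
(`localKerOver_kerSubgroup_eq_top_of_torsion_mem_kernel_of_divisible`), so the tree's mechanism
`SelmerDualData.not_isTorsion_of_localKerOver_eq_top_of_le_card_relaxed_torsion` applies verbatim.
[cite: GreenbergLNM1716, Thm. 1.7 and §2 (potentially supersingular paragraph)] [cite: CoatesGreenberg1996, §4 Props. 4.3, 4.8 (through Coates, LNM 1716 §3, proof of Lemma 3.5)] -/
theorem not_isTorsion_of_torsion_mem_kernel_of_divisible (hCG : H1_goodModelKernel_trivial.{0})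
    (hI1 : relaxedSelmer_torsion_card_growth.{0})
    {κ : ZpExtension K p} {γ : absoluteGaloisGroup K} (D : SelmerDualData W κ γ)
    (hκ : κ.IsCyclotomic) (hγ : κ.IsTopGenerator γ) (hpv : ((p : ℕ) : 𝓞 K) ∈ v.asIdeal)
    (hdiv : ∀ c : discreteH1 (localSubgroup κ.kerSubgroup (v.adicCompletion K))
      (AddCommGroup.primaryComponent (localPoints W (v.adicCompletion K)) p),
      ∃ c', c = p • c') :
    ¬ D.IsTorsion := by
  have hv : W.localKerOver p κ.kerSubgroup (v.adicCompletion K) = ⊤ :=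
    localKerOver_kerSubgroup_eq_top_of_torsion_mem_kernel_of_divisible W p hw hW₀ hΔ htors hCG κ hκ
      hpv hdiv
  obtain ⟨c, hc⟩ := hI1 K W p κ v hpv
  refine D.not_isTorsion_of_localKerOver_eq_top_of_le_card_relaxed_torsion hκ hγ v hv
    (fun n ↦ p ^ n) c (fun B ↦ ?_) hc
  exact ⟨B, Nat.lt_pow_self (Fact.out : p.Prime).one_lt⟩

end Summit.BirchSwinnertonDyer.Rank1Residual.Additive.GoodModelLine

end
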